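import Literature.MathematicalPhysics.QuantumLattice.BalabanRGHaarIterates
import HarnessLib

/-!
# Composition of block RG steps: `n` steps of block size `M` are one step of block size `Mⁿ`

Companion of prelude A18 `Literature/MathematicalPhysics/QuantumLattice/BalabanRG.lean` and of
`BalabanRGHaarIterates.lean`. Everything here is proved; no definition of a proposition and no
named fact is introduced.

## Content

1. Combinatorics of nested blocks: a line edge of a line edge is a line edge of the product
   block size (`lineEdge_lineEdge`), the straight-line block holonomy maps compose,
   `axialBlockHolonomy M ∘ axialBlockHolonomy K = axialBlockHolonomy (K * M)`
   (`axialBlockHolonomy_axialBlockHolonomy`, an instance of `List.prod` over a concatenation of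
   ranges), hence `(axialBlockHolonomy M)^[n] = axialBlockHolonomy (M ^ n)`
   (`axialBlockHolonomy_iterate`); and the fine edge volumes compose the same way,
   `fineEdges K (fineEdges M Λ) = fineEdges (K * M) Λ` (iterated floor division,
   `Int.ediv_ediv_of_nonneg`), `(fineEdges M)^[n] Λ = fineEdges (M ^ n) Λ`.
2. Unwinding the normalised iterates of `BalabanRGHaarIterates`: the measure
   `rgIterate M w₀ n Λ · freeHaarConfig Λ` is a positive finite multiple of the image of the
   level-`0` measure `w₀ (fineEdges (M ^ n) Λ) · freeHaarConfig (fineEdges (M ^ n) Λ)` under the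
   single block holonomy map `axialBlockHolonomy (M ^ n)`
   (`withDensity_rgIterate_eq_smul_map`), hence — by the pushforward formula
   `map_axialBlockHolonomy_withDensity` at block size `M ^ n` — the `n`-th iterate agrees
   `freeHaarConfig Λ`-a.e. with a constant multiple of the explicit one-step density
   `blockStepDensity (M ^ n) Λ (w₀ (fineEdges (M ^ n) Λ))` (`rgIterate_ae_eq_smul_blockStepDensity`).

This is the (elementary) semigroup property of Bałaban's axial-gauge block averaging
(Bałaban, CMP 95 (1984) §1, (1.4)–(1.6): averaging over blocks of side `L^k` in one step or in
`k` steps of side `L` gives the same block field; CMP 109 (1987) (0.1)–(0.2) for the densities),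
in the free-boundary straight-line set-up of prelude A18. It is used by the sibling files proving
cutoff-uniform bounds, where the `n`-fold iterate must be treated as ONE integral over lines of
`Mⁿ` fine links.

## References

* T. Bałaban, *Propagators and renormalization transformations for lattice gauge theories. I*,
  Comm. Math. Phys. 95 (1984) 17–40, §1.
* T. Bałaban, *Renormalization group approach to lattice gauge field theories. I*, Comm. Math.
  Phys. 109 (1987) 249–301, (0.1)–(0.2).
-/

noncomputable section

open MeasureTheory Filter Finset
open scoped ENNReal

namespace Literature.MathematicalPhysics.QuantumLattice

open Literature.Probability.LatticeModels

variable {d N : ℕ} {G : Type*}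

/-! ### Nested block lines -/

/-- A line edge of a line edge: the `s`-th fine edge (block size `K`) of the line of the `t`-th
edge (block size `M`) of the line of `b` is the `(K t + s)`-th edge of the line of `b` for block
size `K M` (Bałaban CMP 95 (1984) §1: straight block lines of nested blocks concatenate). [folklore] -/
theorem lineEdge_lineEdge (K M : ℕ) (b : ZdEdge d) (t s : ℕ) :
    lineEdge K (lineEdge M b t) s = lineEdge (K * M) b (K * t + s) := by
  refine Prod.ext ?_ rfl
  funext i
  simp only [lineEdge, blockBase, Pi.add_apply, Pi.single_apply, Nat.cast_mul, Nat.cast_add]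
  split_ifs <;> ring

section Monoid

variable [Monoid G]

/-- Ordered products over a range of length `K * M` split into `M` consecutive blocks of length
`K` (noncommutative `List.prod`; from `List.range_add`). [folklore] -/
theorem prod_map_range_mul (K M : ℕ) (f : ℕ → G) :
    ((List.range M).map fun t => ((List.range K).map fun s => f (K * t + s)).prod).prod =
      ((List.range (K * M)).map f).prod := by
  induction M with
  | zero => simp
  | succ M ih =>
    rw [List.range_succ, List.map_append, List.prod_append, ih, List.map_singleton,
      List.prod_singleton, Nat.mul_succ, List.range_add, List.map_append, List.prod_append,
      List.map_map]
    rfl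

end Monoid

section Group

variable [Group G]

/-- **Block holonomies compose**: the block holonomy with block size `M` of the block holonomy
with block size `K` is the block holonomy with block size `K * M` — the straight line of `K M`
fine edges from `K M y` to `K M (y + eᵢ)` is the concatenation of the `M` lines of `K` fine edges
between the intermediate corners (Bałaban CMP 95 (1984) §1, (1.4)–(1.6): iterated axial-gauge
block averaging is block averaging over the larger block). [folklore] -/
theorem axialBlockHolonomy_axialBlockHolonomy (K M : ℕ) (U : LGConfig d G) :
    axialBlockHolonomy M (axialBlockHolonomy K U) = axialBlockHolonomy (K * M) U := by
  funext b
  rw [axialBlockHolonomy_apply, axialBlockHolonomy_apply]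
  simp_rw [axialBlockHolonomy_apply K U, lineEdge_lineEdge]
  exact prod_map_range_mul K M fun r => U (lineEdge (K * M) b r)

/-- **`n` block RG holonomy maps of block size `M` are one of block size `Mⁿ`**:
`(axialBlockHolonomy M)^[n] = axialBlockHolonomy (M ^ n)` (Bałaban CMP 95 (1984) §1). [folklore] -/
theorem axialBlockHolonomy_iterate (M n : ℕ) :
    (axialBlockHolonomy (d := d) (G := G) M)^[n] = axialBlockHolonomy (M ^ n) := by
  induction n with
  | zero =>
    funext U
    rw [Function.iterate_zero, pow_zero, id, axialBlockHolonomy_one_left]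
  | succ n ih =>
    rw [Function.iterate_succ', ih]
    funext U
    rw [Function.comp_apply, axialBlockHolonomy_axialBlockHolonomy, pow_succ]

end Group

/-! ### Nested fine edge volumes -/

/-- Coarse edges compose: `⌊⌊x / K⌋ / M⌋ = ⌊x / (K M)⌋` coordinatewise
(`Int.ediv_ediv_of_nonneg`). [folklore] -/
theorem coarseEdge_coarseEdge (K M : ℕ) (e : ZdEdge d) :
    coarseEdge M (coarseEdge K e) = coarseEdge (K * M) e := by
  refine Prod.ext ?_ rfl
  funext i
  simp only [coarseEdge, blockMap, Nat.cast_mul]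
  exact Int.ediv_ediv_of_nonneg (Int.natCast_nonneg K)

/-- **Fine edge volumes compose**: the fine edges (block size `K`) over the fine edges (block
size `M`) over `Λ` are the fine edges of block size `K * M` over `Λ` (Bałaban CMP 95 (1984) §1,
nested blocks). [folklore] -/
theorem fineEdges_fineEdges (K M : ℕ) [NeZero K] [NeZero M] (Λ : Finset (ZdEdge d)) :
    fineEdges K (fineEdges M Λ) = fineEdges (K * M) Λ := by
  haveI : NeZero (K * M) := ⟨mul_ne_zero (NeZero.ne K) (NeZero.ne M)⟩
  ext e
  rw [mem_fineEdges_iff, mem_fineEdges_iff, mem_fineEdges_iff, coarseEdge_coarseEdge]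

/-- With block size `1` the fine edges over `Λ` are `Λ`. [folklore] -/
@[simp] theorem fineEdges_one (Λ : Finset (ZdEdge d)) : fineEdges 1 Λ = Λ := by
  ext e
  rw [mem_fineEdges_iff]
  simp [coarseEdge]

/-- **`n`-fold fine edge volumes**: `(fineEdges M)^[n] Λ = fineEdges (M ^ n) Λ`. [folklore] -/
theorem fineEdges_iterate (M : ℕ) [NeZero M] (n : ℕ) (Λ : Finset (ZdEdge d)) :
    (fineEdges M)^[n] Λ = fineEdges (M ^ n) Λ := by
  induction n generalizing Λ with
  | zero => simp
  | succ n ih =>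
    haveI : NeZero (M ^ n) := ⟨pow_ne_zero n (NeZero.ne M)⟩
    rw [Function.iterate_succ_apply, ih, fineEdges_fineEdges, pow_succ]

/-! ### Unwinding the normalised iterates -/

section Unwind

variable [Group G] [MeasurableSpace G] [TopologicalSpace G] [IsTopologicalGroup G]
  [CompactSpace G] [BorelSpace G] [MeasurableMul₂ G]

/-- **Unwinding the normalised block RG iterates.** For admissible starting weights (as in
`rgIterate_spec`), the measure `ρ_n(Λ, ·) · dV` (`dV = freeHaarConfig Λ`,
`ρ_n = rgIterate M w₀ n`) is a positive finite multiple of the image of the level-`0` measure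
`w₀(Λₙ, ·) · dU` on the `n`-fold fine volume `Λₙ = (fineEdges M)^[n] Λ` under the `n`-fold
block holonomy map `(axialBlockHolonomy M)^[n]`: the `n` normalised block RG steps
(`map_axialBlockHolonomy_withDensity_rgIterate`) compose (Bałaban CMP 109 (1987) (0.1)–(0.2),
iterated). [folklore] -/
theorem withDensity_rgIterate_eq_smul_map (M : ℕ) [NeZero M]
    {w₀ : Finset (ZdEdge d) → LGConfig d G → ℝ≥0∞} {K : ℝ} (hK : 0 ≤ K)
    (hmeas : ∀ Λ, Measurable (w₀ Λ))
    (hpos : ∀ Λ, ∃ m : ℝ≥0∞, m ≠ 0 ∧ ∀ U, m ≤ w₀ Λ U)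
    (hbdd : ∀ Λ, ∃ B : ℝ≥0∞, B ≠ ∞ ∧ ∀ U, w₀ Λ U ≤ B)
    (hosc : ∀ (Λ F : Finset (ZdEdge d)) (U U' : LGConfig d G), (∀ e ∉ F, U e = U' e) →
      w₀ Λ U ≤ ENNReal.ofReal (Real.exp (K * F.card)) * w₀ Λ U')
    (n : ℕ) (Λ : Finset (ZdEdge d)) :
    ∃ c : ℝ≥0∞, c ≠ 0 ∧ c ≠ ∞ ∧
      (freeHaarConfig Λ).withDensity (rgIterate M w₀ n Λ) =
        c • (((freeHaarConfig ((fineEdges M)^[n] Λ)).withDensity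
          (w₀ ((fineEdges M)^[n] Λ))).map ((axialBlockHolonomy M)^[n])) := by
  induction n generalizing Λ with
  | zero => exact ⟨1, one_ne_zero, ENNReal.one_ne_top, by simp⟩
  | succ n ih =>
    obtain ⟨c, hc0, hct, hc⟩ := ih (fineEdges M Λ)
    obtain ⟨hZ0, hZt⟩ := rgIterate_normaliser_ne M hK hmeas hpos hbdd hosc n Λ
    set Z := ∫⁻ U, rgIterate M w₀ n (fineEdges M Λ) U ∂freeHaarConfig (fineEdges M Λ) with hZ
    have hstep := map_axialBlockHolonomy_withDensity_rgIterate M hK hmeas hpos hbdd hosc n Λ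
    have hm := (rgIterate_spec M hK hmeas hpos hbdd hosc (n + 1) Λ).1
    -- `Z • ρ_{n+1} dV = map abh_M (ρ_n dU) = c • map abh_M^[n+1] (w₀ dU₀)`
    have h1 : (freeHaarConfig Λ).withDensity (fun V => Z * rgIterate M w₀ (n + 1) Λ V) =
        Z • (freeHaarConfig Λ).withDensity (rgIterate M w₀ (n + 1) Λ) := by
      rw [← withDensity_smul _ hm]
      rfl
    refine ⟨Z⁻¹ * c, mul_ne_zero (ENNReal.inv_ne_zero.2 hZt) hc0,
      ENNReal.mul_ne_top (ENNReal.inv_ne_top.2 hZ0) hct, ?_⟩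
    have h2 : (freeHaarConfig Λ).withDensity (rgIterate M w₀ (n + 1) Λ) =
        Z⁻¹ • (freeHaarConfig Λ).withDensity (fun V => Z * rgIterate M w₀ (n + 1) Λ V) := by
      rw [h1, smul_smul, ENNReal.inv_mul_cancel hZ0 hZt, one_smul]
    rw [h2, ← hstep, hc, Measure.map_smul, Measure.map_map (measurable_axialBlockHolonomy M)
      ((measurable_axialBlockHolonomy M).iterate n), ← Function.iterate_succ',
      Function.iterate_succ_apply, smul_smul]

/-- **The `n`-th normalised iterate is a.e. a multiple of the one-step density at block size
`Mⁿ`.** For admissible starting weights, `rgIterate M w₀ n Λ` agrees `freeHaarConfig Λ`-a.e. with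
`c · blockStepDensity (M ^ n) Λ (w₀ (fineEdges (M ^ n) Λ))` for a positive finite constant `c`:
`n` block RG steps of block size `M` are one block RG step of block size `Mⁿ`
(`axialBlockHolonomy_iterate`, `fineEdges_iterate`, and the pushforward formula
`map_axialBlockHolonomy_withDensity` at block size `Mⁿ`; Bałaban CMP 95 (1984) §1, CMP 109
(1987) (0.1)–(0.2)). The two functions are versions of the same Radon–Nikodym density
(`withDensity_eq_iff`). [folklore] -/
theorem rgIterate_ae_eq_smul_blockStepDensity (M : ℕ) [NeZero M]
    {w₀ : Finset (ZdEdge d) → LGConfig d G → ℝ≥0∞} {K : ℝ} (hK : 0 ≤ K)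
    (hmeas : ∀ Λ, Measurable (w₀ Λ))
    (hpos : ∀ Λ, ∃ m : ℝ≥0∞, m ≠ 0 ∧ ∀ U, m ≤ w₀ Λ U)
    (hbdd : ∀ Λ, ∃ B : ℝ≥0∞, B ≠ ∞ ∧ ∀ U, w₀ Λ U ≤ B)
    (hosc : ∀ (Λ F : Finset (ZdEdge d)) (U U' : LGConfig d G), (∀ e ∉ F, U e = U' e) →
      w₀ Λ U ≤ ENNReal.ofReal (Real.exp (K * F.card)) * w₀ Λ U')
    (n : ℕ) (Λ : Finset (ZdEdge d)) :
    ∃ c : ℝ≥0∞, c ≠ 0 ∧ c ≠ ∞ ∧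
      rgIterate M w₀ n Λ =ᵐ[freeHaarConfig Λ]
        fun V => c * blockStepDensity (M ^ n) Λ (w₀ (fineEdges (M ^ n) Λ)) V := by
  haveI : NeZero (M ^ n) := ⟨pow_ne_zero n (NeZero.ne M)⟩
  obtain ⟨c, hc0, hct, hc⟩ := withDensity_rgIterate_eq_smul_map M hK hmeas hpos hbdd hosc n Λ
  obtain ⟨hm, -, ⟨B, hBt, hBu⟩, -⟩ := rgIterate_spec M hK hmeas hpos hbdd hosc n Λ
  refine ⟨c, hc0, hct, ?_⟩
  rw [axialBlockHolonomy_iterate, fineEdges_iterate,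
    map_axialBlockHolonomy_withDensity (M ^ n) Λ (hmeas _), ← withDensity_smul _
      (measurable_blockStepDensity (M ^ n) Λ (hmeas _))] at hc
  have hfin : ∫⁻ V, rgIterate M w₀ n Λ V ∂freeHaarConfig Λ ≠ ∞ := by
    refine ne_top_of_le_ne_top hBt ?_
    calc ∫⁻ V, rgIterate M w₀ n Λ V ∂freeHaarConfig Λ
        ≤ ∫⁻ _, B ∂freeHaarConfig (G := G) Λ := lintegral_mono fun V => hBu V
      _ = B := by rw [lintegral_const, measure_univ, mul_one]
  exact (withDensity_eq_iff hm.aemeasurable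
    ((measurable_blockStepDensity (M ^ n) Λ (hmeas _)).const_smul c).aemeasurable hfin).1 hc

end Unwind

end Literature.MathematicalPhysics.QuantumLattice
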